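import Summits.Ventures.PercRepro.RankDistBookSum
import Summits.Ventures.PercRepro.RankDistBottomCumulative

/-!
# PercRepro — C-025 ON EVERY DIRECT SUM OF TWO BOOKS `B_k ⊕ B_l` (p9, gen 23)

The row (SC) fails on `B_k ⊕ B_l` for all large `k, l` (first at `(11, 12)`, `RankDistBookSum`), but every book
satisfies the repaired row (BC) and (BC) is closed under direct sums with no side condition
(`RankDistBottomCumulative`); hence **`rls_bookSumGen`: C-025 `ThmN.RLS` holds on `B_k ⊕ B_l` at
`((k + 1) + (l + 1), k + l)` for every `k, l`** — the whole family of (SC)-counterexamples satisfies the crux.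
Nothing here moves any window of the crux.
-/

namespace PercRepro.RankDist

open Set Finset _root_.Matroid PercRepro.ThmH

/-- `B_k` on the left summand of `Option (Fin k × Bool) ⊕ Option (Fin l × Bool)`. -/
noncomputable abbrev bookLGen (k l : ℕ) : Matroid (Option (Fin k × Bool) ⊕ Option (Fin l × Bool)) :=
  book (Sum.inl : Option (Fin k × Bool) → Option (Fin k × Bool) ⊕ Option (Fin l × Bool)) Sum.inl_injective

/-- `B_l` on the right summand. -/
noncomputable abbrev bookRGen (k l : ℕ) : Matroid (Option (Fin k × Bool) ⊕ Option (Fin l × Bool)) :=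
  book (Sum.inr : Option (Fin l × Bool) → Option (Fin k × Bool) ⊕ Option (Fin l × Bool)) Sum.inr_injective

/-- The two books have disjoint ground sets. -/
lemma disjoint_bookLGen_bookRGen (k l : ℕ) : Disjoint (bookLGen k l).E (bookRGen k l).E := by
  rw [book_ground, book_ground]
  exact Set.isCompl_range_inl_range_inr.disjoint

/-- `B_k ⊕ B_l`. -/
noncomputable abbrev bookSumGen (k l : ℕ) : Matroid (Option (Fin k × Bool) ⊕ Option (Fin l × Bool)) :=
  (bookLGen k l).disjointSum (bookRGen k l) (disjoint_bookLGen_bookRGen k l)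

/-- `B_k ⊕ B_l` is a finite matroid. -/
lemma bookSumGen_finite (k l : ℕ) : (bookSumGen k l).Finite :=
  ⟨by rw [disjointSum_ground_eq]; exact (bookLGen k l).ground_finite.union (bookRGen k l).ground_finite⟩

/-- **`B_k ⊕ B_l` satisfies (BC)** at `((k + 1) + (l + 1), k + l)`. -/
theorem bottomCumulativeTop_bookSumGen (k l : ℕ) [hS : (bookSumGen k l).Finite] :
    BottomCumulativeTop (bookSumGen k l) ((k + 1) + (l + 1)) (k + l) :=
  bottomCumulativeTop_disjointSum (bookLGen k l) (bookRGen k l) (disjoint_bookLGen_bookRGen k l)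
    (card_gr_book _ Sum.inl_injective) (eRank_book _ Sum.inl_injective) (card_gr_book _ Sum.inr_injective)
    (eRank_book _ Sum.inr_injective) (by omega) (by omega) (bottomCumulativeTop_book _ Sum.inl_injective)
    (bottomCumulativeTop_book _ Sum.inr_injective)

/-- **C-025 holds on every `B_k ⊕ B_l`**. -/
theorem rls_bookSumGen (k l : ℕ) [hS : (bookSumGen k l).Finite] :
    ThmN.RLS (bookSumGen k l) ((k + 1) + (l + 1)) (k + l) :=
  rls_of_bottomCumulativeTop _ _ _ (bottomCumulativeTop_bookSumGen k l)

/-- **C-025 on every `B_k ⊕ B_l`, with the finiteness instance supplied.** -/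
theorem rls_bookSumGen' (k l : ℕ) :
    @ThmN.RLS _ (bookSumGen k l) (bookSumGen_finite k l) ((k + 1) + (l + 1)) (k + l) :=
  @rls_bookSumGen k l (bookSumGen_finite k l)

end PercRepro.RankDist
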